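import Literature.AnabelianGeometry.AbsoluteAnabelian.ProfiniteOuterSemidirectProduct
import HarnessLib

/-!
# `(G ⋊^out J) / G ≅ J` as topological groups ([SemiAnbd] §0 p. 5; [AbsTopII] Def 1.2 (ii) `Π_H / Π_𝔾 = H`)

Mochizuki, *Semi-graphs of anabelioids*, Publ. RIMS **42** (2006), §0 p. 5 ("a natural exact sequence
`1 → G → G ⋊^out J → J → 1`") [cite: MochizukiSemiAnbd2006, §0 p.5]; [AbsTopII] Def 1.2 (ii) p. 10
(`Π_H / Π_𝔾 ≅ H`).

Companion of `ProfiniteOuterSemidirectProduct.lean` (abc-iut cell, GAP row «G-P13-GR», abc-iut-w5-d151 g4):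
the TOPOLOGICAL first isomorphism theorem for a continuous surjective homomorphism out of a COMPACT group
onto a Hausdorff group (`ContinuousMonoidHom.quotientKerEquivOfSurjectiveOfCompact` — the algebraic
`QuotientGroup.quotientKerEquivOfSurjective` is continuous from the quotient topology and a continuous
bijection compact → Hausdorff is a homeomorphism), and its instance
**`outerSemidirectProfiniteQuotientEquiv : (G ⋊^out J) ⧸ ker(snd) ≃ₜ* J`** with `ker(snd) = inl(G)`
(`range_inlProfinite_eq_ker`).  Nothing here bears on [IUTchIII] Cor. 3.12.
-/

namespace Literature.AnabelianGeometry.AbsoluteAnabelian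

open Literature.AnabelianGeometry.EtaleTheta Literature.AnabelianGeometry.SemiGraphs
open Topology

universe u v

/-! ### Topological first isomorphism theorem, compact source -/

section FirstIso

variable {E : Type u} [Group E] [TopologicalSpace E] {A : Type v} [Group A] [TopologicalSpace A]
  (f : E →ₜ* A) (hf : Function.Surjective f)

/-- The algebraic isomorphism `E ⧸ ker f ≃* A` of a surjective homomorphism is CONTINUOUS for the
quotient topology. [cite: MochizukiSemiAnbd2006, §0 p.5] -/
theorem continuous_quotientKerEquivOfSurjective :
    Continuous (QuotientGroup.quotientKerEquivOfSurjective f.toMonoidHom hf) := by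
  refine (QuotientGroup.isQuotientMap_mk _).continuous_iff.mpr ?_
  have : (QuotientGroup.quotientKerEquivOfSurjective f.toMonoidHom hf) ∘ QuotientGroup.mk = f := by
    funext x; rfl
  rw [this]
  exact f.continuous

variable [CompactSpace E] [T2Space A]

/-- **Topological first isomorphism theorem (compact source, Hausdorff target)**: a continuous
surjective homomorphism `f : E → A` from a compact group onto a Hausdorff group induces an isomorphism of
TOPOLOGICAL groups `E ⧸ ker f ≃ₜ* A` (a continuous bijection from the compact quotient to the Hausdorff
`A` is a homeomorphism). [cite: MochizukiSemiAnbd2006, §0 p.5] -/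
noncomputable def ContinuousMonoidHom.quotientKerEquivOfSurjectiveOfCompact : E ⧸ f.toMonoidHom.ker ≃ₜ* A :=
  { QuotientGroup.quotientKerEquivOfSurjective f.toMonoidHom hf,
    Continuous.homeoOfEquivCompactToT2
      (f := (QuotientGroup.quotientKerEquivOfSurjective f.toMonoidHom hf).toEquiv)
      (continuous_quotientKerEquivOfSurjective f hf) with }

/-- The topological isomorphism on classes: `[x] ↦ f x`. [cite: MochizukiSemiAnbd2006, §0 p.5] -/
@[simp] theorem ContinuousMonoidHom.quotientKerEquivOfSurjectiveOfCompact_mk (x : E) :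
    ContinuousMonoidHom.quotientKerEquivOfSurjectiveOfCompact f hf (QuotientGroup.mk x) = f x := rfl

end FirstIso

/-! ### `(G ⋊^out J) / G ≅ J` -/

section Semidirect

variable {G : Type u} [Group G] [TopologicalSpace G] [IsTopologicalGroup G] [CompactSpace G]
  [TotallyDisconnectedSpace G] (hG : IsTopologicallyFinitelyGenerated G)
  {J : Type u} [Group J] [TopologicalSpace J] [IsTopologicalGroup J] [CompactSpace J]
  [TotallyDisconnectedSpace J] (θ : J →ₜ* outProfinite hG)

/-- **`(G ⋊^out J) ⧸ ker(snd) ≃ₜ* J`** as topological groups — with `ker(snd) = inl(G)`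
(`range_inlProfinite_eq_ker`) this is [AbsTopII] Def 1.2 (ii)'s `Π_H / Π_𝔾 ≅ H`.
[cite: MochizukiSemiAnbd2006, §0 p.5] -/
noncomputable def outerSemidirectProfiniteQuotientEquiv :
    outerSemidirectProfinite hG θ ⧸ (sndProfinite hG θ).toMonoidHom.ker ≃ₜ* J :=
  ContinuousMonoidHom.quotientKerEquivOfSurjectiveOfCompact (sndProfinite hG θ) (sndProfinite_surjective hG θ)

/-- On classes: `[p] ↦ p.2`. [cite: MochizukiSemiAnbd2006, §0 p.5] -/
@[simp] theorem outerSemidirectProfiniteQuotientEquiv_mk (p : outerSemidirectProfinite hG θ) :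
    outerSemidirectProfiniteQuotientEquiv hG θ (QuotientGroup.mk p) = p.1.2 := rfl

/-- The subgroup being divided out IS the image of `G`: `ker(snd) = range(inl)`.
[cite: MochizukiSemiAnbd2006, §0 p.5] -/
theorem ker_sndProfinite_eq_range_inlProfinite :
    (sndProfinite hG θ).toMonoidHom.ker = (inlProfinite hG θ).toMonoidHom.range :=
  (range_inlProfinite_eq_ker hG θ).symm

end Semidirect

end Literature.AnabelianGeometry.AbsoluteAnabelian
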